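import Summits.BirchSwinnertonDyer.BirchSwinnertonDyer.Theorems.PrintX10bBeyondCarrierOfTenPrintLeavesIntendedClosed
import Summits.BirchSwinnertonDyer.BirchSwinnertonDyer.Theorems.PoitouTateSelmerStructureDualityConjHolds
import Literature.NumberTheory.GaloisCohomology.Howard2004.Thm161PrintIntendedOfEngineBricks
import Literature.NumberTheory.GaloisCohomology.Howard2004.EngineDecompositionsOfSkewPairingIntendedProofs
import Literature.NumberTheory.GaloisCohomology.Howard2004.TowerZModLeftKernelPairingProofs
import Summits.BirchSwinnertonDyer.BirchSwinnertonDyer.Theorems.SchneiderFreeAdditiveX3PoitouTateShaDualityHolds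
import HarnessLib

/-!
# Crux `BeyondCarrierDepthX10b` (stmt-BirchSwinnertonDyer-23055, PrintX10b aside r301), line «twins» — CENSUS OF RECORD v2: the crux BY
# NAME from TEN cite-only print facts with Howard's Thm. 1.6.1 REPLACED by Howard Prop. 1.4.1 / Thm. 1.4.2 (Flach's pairing, C45.1′)

HONEST FRAMING (cell `run/shared/lean/pub/bsd-print-x9/`, seat bsd-line-x10b-p1 LEAD g13, registered line «twins», skeleton v8
`Cruxes/BeyondCarrierDepthX10b/Lines/twins.lean` sha d9aa95dab226; D-0154 KEY row 10): THEOREMS ONLY, conditional glue `--supports 23055`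
(helper); nothing booked, nothing closed. «beyond-print theorem»: NO. BSD is not proved by any of this; no summit statement is proved by
this seat.

COMPOSITION (part C4 of CENSUS-23055-INTENDED). Part C3 (`PrintX10bBeyondCarrierOfTenPrintLeavesIntendedClosed`) gives the crux from TEN cite-only
leaves with Howard Thm. 1.6.1 entering AS INTENDED (F-161′, `thm161_dvrKolyvaginBound_printIntended`).  The cell's engine + residual programme
(seats bsd-line-x10b-p1 / -x9-p1 and widths, 2026-08-28/29; closing file `Howard2004/Thm161PrintIntendedOfEngineBricks`, x10b-p1-w2 g17)
proves F-161′ in the kernel from ONE print input, C45.1′ = Howard Prop. 1.4.1 / Thm. 1.4.2 as applied (`prop141_casselsTate_skewPairing_atLevel`,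
Flach 1990's Cassels–Tate pairing), and Poitou–Tate duality for Selmer structures — the latter a KERNEL theorem Summits-side
(`InputsPoitouTateSelmer.poitouTate_selmerStructure_duality_conj_holds`, canonical local invariants).  Hence:
* **`HowardFrames.beyondCarrierDepthX10b_of_tenPrintLeaves_prop141 (hCGLS h57 h59gp h422 h513 h331 hChaL hKo h141 h411) : BeyondCarrierDepthX10b`**
  — CENSUS OF RECORD v2 for stmt-23055: still TEN cite-only print facts — CGLS Thm. 4.1.3 (`hCGLS`) · Castella/Yan–Zhu Thm. 5.7 (1) (`h57`) ·
  the pinned (T2)-general transfer (`h59gp`) · BCS Prop. 4.2.2 (`h422`) · CGLS Thm. 5.1.3 (`h513`) · JSW Thm. 3.3.1 (`h331`) · Cha Rmk. 25 (`hChaL`) ·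
  Kolyvagin Thm. A (`hKo`) · **Howard Prop. 1.4.1 / Thm. 1.4.2 (`h141`)** · CGLS Thm. 4.1.1 KS form (`h411`) — with the leaf «Howard Thm. 1.6.1»
  (census v1, p695500) replaced by the strictly smaller «Howard Prop. 1.4.1 / Thm. 1.4.2».
* §2 (append, LEAD g13) **`beyondCarrierDepthX10b_of_tenPrintLeaves_prop141_printIntended (… h141″ …)`** — CENSUS v3: the same with the
  Howard/Flach leaf PRINT-AS-INTENDED, C45.1″ `prop141_casselsTate_skewPairing_atLevel_printIntended` (lit g46 p722866, REF-177/178), via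
  x10b-p1-w7 g12's `thm161_printIntended_of_prop141_printIntended` (p723075).
What is NOT proved: any of the ten leaves; the crux unconditionally; BSD.

References: [Howard2004HeegnerKolyvagin] Prop. 1.4.1, Thm. 1.4.2, Thm. 1.6.1 (arXiv Thm. 2.6.1; print-as-intended scope p0004 L47–52,
p0006 L84–92), Thm. 2.2.10 (proof); [Flach1990] (Crelle 412); [MilneADT2006] Ch. I Thm. 4.10; [CastellaGrossiLeeSkinner2022] Thm. 4.1.1,
4.1.3, 5.1.3; [YanZhu2024MainConjNonCM] Thm. 5.7 (1), 5.9; [BurungaleCastellaSkinner2025] Prop. 4.2.2; [JetchevSkinnerWan2017] Thm. 3.3.1;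
[Cha2005] Rmk. 25; [Kolyvagin1990] Thm. A.
-/

-- the REGISTERED stub namespace `Summit.BirchSwinnertonDyer.BirchSwinnertonDyer.Cruxes.…` repeats the summit name
set_option linter.dupNamespace false
set_option autoImplicit false

noncomputable section

open scoped Classical Pointwise ContRepresentation TensorProduct NumberField

open WeierstrassCurve NumberField IsDedekindDomain Field Literature Literature.NumberTheory.EllipticCurves
  Literature.NumberTheory.EllipticCurves.ModularForms Literature.NumberTheory.EllipticCurves.Rank1Residual
  Literature.NumberTheory.EllipticCurves.Castella2018 Literature.NumberTheory.EllipticCurves.YanZhu2026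
  Literature.NumberTheory.EllipticCurves.CastellaGrossiLeeSkinner2022
  Literature.NumberTheory.EllipticCurves.JetchevSkinnerWan2017
open Literature.NumberTheory.GaloisCohomology Literature.NumberTheory.GaloisCohomology.Howard2004
open Literature.NumberTheory.GaloisRepresentations Literature.NumberTheory.GaloisRepresentations.DiscreteGaloisModule

open Summit.BirchSwinnertonDyer.Rank1Residual
open Summit.BirchSwinnertonDyer.BirchSwinnertonDyer.Theorems
open Summit.BirchSwinnertonDyer.BirchSwinnertonDyer.Theorems.HeegnerMuPartControlGlue (Stmt.kummerStrictOnFrames)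
open Summit.BirchSwinnertonDyer.BirchSwinnertonDyer.Theses.PrintX10b (BeyondCarrierDepthX10b)

namespace Summit.BirchSwinnertonDyer.BirchSwinnertonDyer.Cruxes.BeyondCarrierDepthX10b.HowardFrames

/-- **CENSUS OF RECORD v2 — crux `BeyondCarrierDepthX10b` (stmt-BirchSwinnertonDyer-23055) BY NAME from TEN cite-only print facts with
Howard's Thm. 1.6.1 REPLACED by the strictly smaller print input C45.1′ = Howard Prop. 1.4.1 / Thm. 1.4.2 as applied (Flach's
Cassels–Tate pairing, `prop141_casselsTate_skewPairing_atLevel`)**: `hCGLS` CGLS Thm. 4.1.3 · `h57` `h59gp` `h422` `h513` `h331` · `hChaL`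
Cha Rmk. 25 · `hKo` Kolyvagin Thm. A · `h141` Howard Prop. 1.4.1/Thm. 1.4.2 · `h411` CGLS Thm. 4.1.1 (KS form).  Thm. 1.6.1 itself enters as
the cell's KERNEL theorem `DVRSetting.thm161_printIntended_of_prop141 h141 hPT : thm161_dvrKolyvaginBound_printIntended` (the engine +
residual programme of 2026-08-29, closing file `Howard2004/Thm161PrintIntendedOfEngineBricks`), with Poitou–Tate for Selmer structures
`hPT` DISCHARGED by the Summits-side kernel theorem `InputsPoitouTateSelmer.poitouTate_selmerStructure_duality_conj_holds`; then part C3's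
`beyondCarrierDepthX10b_of_tenPrintLeaves_intended`.  What is NOT proved: any of the ten leaves; the crux unconditionally; BSD.  CONDITIONAL;
credits nothing.
[cite: Howard2004HeegnerKolyvagin, Prop. 1.4.1, Thm. 1.4.2, Thm. 1.6.1 and Thm. 2.2.10 (proof)] [cite: CastellaGrossiLeeSkinner2022, Thm. 4.1.1, Thm. 4.1.3 and Thm. 5.1.3]
[cite: YanZhu2024MainConjNonCM, Thm. 5.7 (1), 5.9] [cite: BurungaleCastellaSkinner2025, Prop. 4.2.2] [cite: JetchevSkinnerWan2017, Thm. 3.3.1]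
[cite: Cha2005, Rmk. 25] [cite: Kolyvagin1990, Thm. A] [cite: MilneADT2006, Ch. I Thm. 4.10] -/
theorem beyondCarrierDepthX10b_of_tenPrintLeaves_prop141
    (hCGLS : thm413_rankOne_charIdeal_torsion_dvd_localized.{0})
    (h57 : thm57_isTorsion_charIdealXGr_eq_bdpLFunction)
    (h59gp : ∀ {p : ℕ} [Fact p.Prime] (ι' : PadicAlgCl p ≃+* ℂ) (W : WeierstrassCurve ℚ) [W.IsElliptic]
      [W.IsGloballyMinimal] (K : Type) [Field K] [NumberField K] (v vbar : HeightOneSpectrum (𝓞 K))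
      (κ : ZpExtension K p) (γ : absoluteGaloisGroup K) [Fact (κ.IsTopGenerator γ)] {N : ℕ} [NeZero N]
      {f : CuspForm (CongruenceSubgroup.Gamma0 N) 2} (jbar : AlgebraicClosure K →+* ℂ)
      (_ : IsNewformOf W f),
      N = W.conductorNorm ℤ → 3 ≤ p → GoodOrd W p → (W.baseChange K).HasIrreducibleModPGaloisRep p →
      IsImaginaryQuadratic K → SatisfiesHeegnerHypothesis N K →
        ((Ideal.span {(p : ℤ)}).primesOver (𝓞 K)).ncard = 2 →
        Odd (NumberField.discr K) → NumberField.discr K ≠ -3 → κ.IsAnticyclotomic →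
      (∀ (w : InfinitePlace K) (k : 𝓞 K), k ∈ v.asIdeal ↔ ‖ι'.symm (w.embedding (k : K))‖ < 1) →
        ((p : ℕ) : 𝓞 K) ∈ vbar.asIdeal → vbar ≠ v →
      ∃ (ΩK : ℂ) (Ωp : (unrIntegers p)ˣ) (L : UnrSeries p),
        ΩK ≠ 0 ∧ IsBDPLFunction ι' v κ γ f ΩK ((Ωp : unrIntegers p) : ℂ_[p]) L ∧
        ∀ (D : (W.baseChange K).LambdaAdicSelmerData κ γ) (F : HeegnerFamily N W K κ jbar)
          (X : (W.baseChange K).SelmerDualData κ γ) (j : ℤ_[p] →+* unrIntegers p),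
          ¬ (p : ℤ) ∣ F.Dt.c →
          (∀ x : ℤ_[p], ((j x : unrIntegers p) : ℂ_[p]) = algebraMap ℚ_[p] ℂ_[p] (x : ℚ_[p])) →
          heegnerCharIdeal D F ^ 2 ≤
              Module.charIdeal (IwasawaAlgebra p) (Submodule.torsion (IwasawaAlgebra p) X.X) →
            L ∈ (AcSelmer.XAc.charIdeal (W.baseChange K) p κ vbar ∅ γ).map (PowerSeries.map j))
    (h422 : BurungaleCastellaSkinner2025.prop422_exists_isBDPLFunction_mu_eq_zero)
    (h513 : thm513_exists_isBDPLFunction_valueAtOne_disc)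
    (h331 : thm331_anticyclotomicControl)
    (hChaL : Cha2005.rmk25_pow_dvd_card_sha_primary_of_certificate)
    (hKo : ∀ (N : ℕ) [NeZero N] (W : WeierstrassCurve ℚ) (K : Type) [Field K] [NumberField K],
      kolyvagin N W K)
    (h141 : Literature.NumberTheory.GaloisCohomology.Howard2004.prop141_casselsTate_skewPairing_atLevel)
    (h411 : CastellaGrossiLeeSkinner2022.thm411_exists_kolyvaginSystem_one_ne_zero) :
    BeyondCarrierDepthX10b :=
  beyondCarrierDepthX10b_of_tenPrintLeaves_intended hCGLS h57 h59gp h422 h513 h331 hChaL hKo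
    (Literature.NumberTheory.GaloisCohomology.Howard2004.DVRSetting.thm161_printIntended_of_prop141 h141
      fun K _ _ => InputsPoitouTateSelmer.poitouTate_selmerStructure_duality_conj_holds K)
    h411

/-! ## §2 (append) Census of record v3: the Howard/Flach leaf PRINT-AS-INTENDED (C45.1″) -/

/-- **CENSUS OF RECORD v3 — crux `BeyondCarrierDepthX10b` (stmt-BirchSwinnertonDyer-23055) BY NAME from TEN cite-only print facts with the
Howard/Flach leaf taken PRINT-AS-INTENDED: `h141 : prop141_casselsTate_skewPairing_atLevel_printIntended` (C45.1″, lit g46 p722866 — C45.1′'s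
body with the two standing guards `(p : R) ≠ 0`, `p ∤ #𝓞_K^×` of Howard's printed proofs, REF-177/178; C45.1′ as worded is stronger than print
on the corner `(p, d_K) = (3, −3)`, `n ≠ ∅`)**; the other nine leaves as in v2.  Howard's Thm. 1.6.1 enters as the cell's KERNEL theorem
`DVRSetting.thm161_printIntended_of_prop141_printIntended h141 hPT` (x10b-p1-w7 g12 p723075, C451″-GLUE over x10b-p1-w2's closing file), Poitou–Tate
DISCHARGED Summits-side by `InputsPoitouTateSelmer.poitouTate_selmerStructure_duality_conj_holds`; then part C3's
`beyondCarrierDepthX10b_of_tenPrintLeaves_intended`.  COUNT UNCHANGED (ten cite-only leaves); every tree consumer of the crux sits inside the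
intended scope (X10b frames: `d_K` odd, `≠ −3`).  What is NOT proved: any of the ten leaves; the crux unconditionally; BSD.  CONDITIONAL; credits
nothing.
[cite: Howard2004HeegnerKolyvagin, Prop. 1.4.1, Thm. 1.4.2, Lemma 1.5.1, Thm. 1.6.1 (print-as-intended scope p0004 L47–52, p0006 L84–92) and Thm. 2.2.10 (proof)]
[cite: CastellaGrossiLeeSkinner2022, Thm. 4.1.1, Thm. 4.1.3 and Thm. 5.1.3] [cite: YanZhu2024MainConjNonCM, Thm. 5.7 (1), 5.9]
[cite: BurungaleCastellaSkinner2025, Prop. 4.2.2] [cite: JetchevSkinnerWan2017, Thm. 3.3.1] [cite: Cha2005, Rmk. 25] [cite: Kolyvagin1990, Thm. A]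
[cite: MilneADT2006, Ch. I Thm. 4.10] -/
theorem beyondCarrierDepthX10b_of_tenPrintLeaves_prop141_printIntended
    (hCGLS : thm413_rankOne_charIdeal_torsion_dvd_localized.{0})
    (h57 : thm57_isTorsion_charIdealXGr_eq_bdpLFunction)
    (h59gp : ∀ {p : ℕ} [Fact p.Prime] (ι' : PadicAlgCl p ≃+* ℂ) (W : WeierstrassCurve ℚ) [W.IsElliptic]
      [W.IsGloballyMinimal] (K : Type) [Field K] [NumberField K] (v vbar : HeightOneSpectrum (𝓞 K))
      (κ : ZpExtension K p) (γ : absoluteGaloisGroup K) [Fact (κ.IsTopGenerator γ)] {N : ℕ} [NeZero N]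
      {f : CuspForm (CongruenceSubgroup.Gamma0 N) 2} (jbar : AlgebraicClosure K →+* ℂ)
      (_ : IsNewformOf W f),
      N = W.conductorNorm ℤ → 3 ≤ p → GoodOrd W p → (W.baseChange K).HasIrreducibleModPGaloisRep p →
      IsImaginaryQuadratic K → SatisfiesHeegnerHypothesis N K →
        ((Ideal.span {(p : ℤ)}).primesOver (𝓞 K)).ncard = 2 →
        Odd (NumberField.discr K) → NumberField.discr K ≠ -3 → κ.IsAnticyclotomic →
      (∀ (w : InfinitePlace K) (k : 𝓞 K), k ∈ v.asIdeal ↔ ‖ι'.symm (w.embedding (k : K))‖ < 1) →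
        ((p : ℕ) : 𝓞 K) ∈ vbar.asIdeal → vbar ≠ v →
      ∃ (ΩK : ℂ) (Ωp : (unrIntegers p)ˣ) (L : UnrSeries p),
        ΩK ≠ 0 ∧ IsBDPLFunction ι' v κ γ f ΩK ((Ωp : unrIntegers p) : ℂ_[p]) L ∧
        ∀ (D : (W.baseChange K).LambdaAdicSelmerData κ γ) (F : HeegnerFamily N W K κ jbar)
          (X : (W.baseChange K).SelmerDualData κ γ) (j : ℤ_[p] →+* unrIntegers p),
          ¬ (p : ℤ) ∣ F.Dt.c →
          (∀ x : ℤ_[p], ((j x : unrIntegers p) : ℂ_[p]) = algebraMap ℚ_[p] ℂ_[p] (x : ℚ_[p])) →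
          heegnerCharIdeal D F ^ 2 ≤
              Module.charIdeal (IwasawaAlgebra p) (Submodule.torsion (IwasawaAlgebra p) X.X) →
            L ∈ (AcSelmer.XAc.charIdeal (W.baseChange K) p κ vbar ∅ γ).map (PowerSeries.map j))
    (h422 : BurungaleCastellaSkinner2025.prop422_exists_isBDPLFunction_mu_eq_zero)
    (h513 : thm513_exists_isBDPLFunction_valueAtOne_disc)
    (h331 : thm331_anticyclotomicControl)
    (hChaL : Cha2005.rmk25_pow_dvd_card_sha_primary_of_certificate)
    (hKo : ∀ (N : ℕ) [NeZero N] (W : WeierstrassCurve ℚ) (K : Type) [Field K] [NumberField K],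
      kolyvagin N W K)
    (h141 : Literature.NumberTheory.GaloisCohomology.Howard2004.prop141_casselsTate_skewPairing_atLevel_printIntended)
    (h411 : CastellaGrossiLeeSkinner2022.thm411_exists_kolyvaginSystem_one_ne_zero) :
    BeyondCarrierDepthX10b :=
  beyondCarrierDepthX10b_of_tenPrintLeaves_intended hCGLS h57 h59gp h422 h513 h331 hChaL hKo
    (Literature.NumberTheory.GaloisCohomology.Howard2004.DVRSetting.thm161_printIntended_of_prop141_printIntended h141
      fun K _ _ => InputsPoitouTateSelmer.poitouTate_selmerStructure_duality_conj_holds K)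
    h411

/-! ## §3 (append) Census of record v4: the Howard/Flach leaf DISCHARGED in the kernel (NINE cite-only leaves) -/

/-- **CENSUS OF RECORD v4 — crux `BeyondCarrierDepthX10b` (stmt-BirchSwinnertonDyer-23055) BY NAME from NINE cite-only print facts:
the Howard/Flach leaf `h141 : prop141_casselsTate_skewPairing_atLevel_printIntended` (C45.1″ = Howard 2004 Prop. 1.4.1 / Thm. 1.4.2,
Flach's generalised Cassels–Tate skew pairing at level, print-as-intended) of v3 is NO LONGER A HYPOTHESIS: it is the cell's kernel
theorem `prop141_casselsTate_skewPairing_atLevel_printIntended_of_poitouTate hC hST hPTS` (bsd-line-x10b-p1 LEAD g14, p729060 — the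
class-level port «C451-CL»: `Ш¹(K, T̄) = 0` from H.2 + Čebotarev, hence `Ш²(K, T̄) = 0` by Poitou–Tate, hence every Selmer class lifts
one level and the Flach / Mazur–Rubin pairing is the sum of local Tate pairings of lifting defects; left kernel by Poitou–Tate for Selmer
structures, right kernel by the transpose adjunction, skew-symmetry on the image of `𝓗_{t+1}` by reciprocity at level `t+1` and the
`τ`-flip; values read in the socle `ℤ/p`), with its three inputs DISCHARGED by tree theorems: Čebotarev for Artin representations
`Automorphic.chebotarev_artinRep_of_galoisSide`, Poitou–Tate duality `Ш¹ × Ш²` `SchneiderFreeAdditiveX3.PoitouTateReduction.poitouTate_sha_tateDual_holds`,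
and Poitou–Tate for Selmer structures `InputsPoitouTateSelmer.poitouTate_selmerStructure_duality_conj_holds`.  The remaining NINE leaves are
v3's: `hCGLS` (CGLS 4.1.3), `h57` (YZ 5.7), `h59gp`, `h422` (BCS 4.2.2), `h513`, `h331` (JSW 3.3.1), `hChaL` (Cha Rmk. 25), `hKo` (Kolyvagin
Thm. A), `h411` (CGLS 4.1.1).  What is NOT proved: any of the nine leaves; the crux unconditionally; BSD.  CONDITIONAL; credits nothing;
no summit statement is proved here.
[cite: Howard2004HeegnerKolyvagin, Prop. 1.4.1, Thm. 1.4.2, Lemma 1.5.1, Thm. 1.6.1 and Thm. 2.2.10 (proof)] [cite: Flach1990, Thm. 1, Thm. 2]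
[cite: MorganSmith2021CTP, Thm. 1.3] [cite: CastellaGrossiLeeSkinner2022, Thm. 4.1.1, Thm. 4.1.3 and Thm. 5.1.3] [cite: YanZhu2024MainConjNonCM, Thm. 5.7 (1), 5.9]
[cite: BurungaleCastellaSkinner2025, Prop. 4.2.2] [cite: JetchevSkinnerWan2017, Thm. 3.3.1] [cite: Cha2005, Rmk. 25] [cite: Kolyvagin1990, Thm. A]
[cite: MilneADT2006, Ch. I Thm. 4.10] [cite: TateGCFT1967, §2.4] -/
theorem beyondCarrierDepthX10b_of_ninePrintLeaves
    (hCGLS : thm413_rankOne_charIdeal_torsion_dvd_localized.{0})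
    (h57 : thm57_isTorsion_charIdealXGr_eq_bdpLFunction)
    (h59gp : ∀ {p : ℕ} [Fact p.Prime] (ι' : PadicAlgCl p ≃+* ℂ) (W : WeierstrassCurve ℚ) [W.IsElliptic]
      [W.IsGloballyMinimal] (K : Type) [Field K] [NumberField K] (v vbar : HeightOneSpectrum (𝓞 K))
      (κ : ZpExtension K p) (γ : absoluteGaloisGroup K) [Fact (κ.IsTopGenerator γ)] {N : ℕ} [NeZero N]
      {f : CuspForm (CongruenceSubgroup.Gamma0 N) 2} (jbar : AlgebraicClosure K →+* ℂ)
      (_ : IsNewformOf W f),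
      N = W.conductorNorm ℤ → 3 ≤ p → GoodOrd W p → (W.baseChange K).HasIrreducibleModPGaloisRep p →
      IsImaginaryQuadratic K → SatisfiesHeegnerHypothesis N K →
        ((Ideal.span {(p : ℤ)}).primesOver (𝓞 K)).ncard = 2 →
        Odd (NumberField.discr K) → NumberField.discr K ≠ -3 → κ.IsAnticyclotomic →
      (∀ (w : InfinitePlace K) (k : 𝓞 K), k ∈ v.asIdeal ↔ ‖ι'.symm (w.embedding (k : K))‖ < 1) →
        ((p : ℕ) : 𝓞 K) ∈ vbar.asIdeal → vbar ≠ v →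
      ∃ (ΩK : ℂ) (Ωp : (unrIntegers p)ˣ) (L : UnrSeries p),
        ΩK ≠ 0 ∧ IsBDPLFunction ι' v κ γ f ΩK ((Ωp : unrIntegers p) : ℂ_[p]) L ∧
        ∀ (D : (W.baseChange K).LambdaAdicSelmerData κ γ) (F : HeegnerFamily N W K κ jbar)
          (X : (W.baseChange K).SelmerDualData κ γ) (j : ℤ_[p] →+* unrIntegers p),
          ¬ (p : ℤ) ∣ F.Dt.c →
          (∀ x : ℤ_[p], ((j x : unrIntegers p) : ℂ_[p]) = algebraMap ℚ_[p] ℂ_[p] (x : ℚ_[p])) →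
          heegnerCharIdeal D F ^ 2 ≤
              Module.charIdeal (IwasawaAlgebra p) (Submodule.torsion (IwasawaAlgebra p) X.X) →
            L ∈ (AcSelmer.XAc.charIdeal (W.baseChange K) p κ vbar ∅ γ).map (PowerSeries.map j))
    (h422 : BurungaleCastellaSkinner2025.prop422_exists_isBDPLFunction_mu_eq_zero)
    (h513 : thm513_exists_isBDPLFunction_valueAtOne_disc)
    (h331 : thm331_anticyclotomicControl)
    (hChaL : Cha2005.rmk25_pow_dvd_card_sha_primary_of_certificate)
    (hKo : ∀ (N : ℕ) [NeZero N] (W : WeierstrassCurve ℚ) (K : Type) [Field K] [NumberField K],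
      kolyvagin N W K)
    (h411 : CastellaGrossiLeeSkinner2022.thm411_exists_kolyvaginSystem_one_ne_zero) :
    BeyondCarrierDepthX10b :=
  beyondCarrierDepthX10b_of_tenPrintLeaves_prop141_printIntended hCGLS h57 h59gp h422 h513 h331 hChaL hKo
    (Literature.NumberTheory.GaloisCohomology.Howard2004.prop141_casselsTate_skewPairing_atLevel_printIntended_of_poitouTate
      Literature.NumberTheory.Automorphic.chebotarev_artinRep_of_galoisSide
      (fun K _ _ => SchneiderFreeAdditiveX3.PoitouTateReduction.poitouTate_sha_tateDual_holds K)
      fun K _ _ => InputsPoitouTateSelmer.poitouTate_selmerStructure_duality_conj_holds K)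
    h411

end Summit.BirchSwinnertonDyer.BirchSwinnertonDyer.Cruxes.BeyondCarrierDepthX10b.HowardFrames

end
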